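import Literature.NumberTheory.Weil1964.ArchFollandCoordinates
import Literature.NumberTheory.Weil1964.ArchFollandTorus
import HarnessLib

/-!
# The place-by-place compact torus in adelic Folland coordinates (the archimedean `κ`-sign, STEP 2)

Topic `NumberTheory/Weil1964`; namespace `Literature.NumberTheory.Weil1964`. Definitions and proved lemmas only:
**no named facts, no records, 0 proof holes**.

**Setting.** `F` a TOTALLY REAL number field (so `mixedSpace F = ℝ^{real places} × ℂ^∅`, `isEmpty_isComplex`), `ι` a
finite index type, an `F`-rational DIAGONAL Gram matrix `T = diag(t₀) ⊗ 1 ∈ M_ι(𝔸_F)` (`t₀ : ι → F`, hypothesis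
`hT : T = (diagonal t₀).map (algebraMap F 𝔸_F)`; archimedean part `archMat T = diag(σ(t₀))`, `archMat_diagonal`), and
the
adelic Folland coordinates `archFolland T e` of `ArchFollandCoordinates` in the **scaled real-place frame**
`e_D = scaledFrame F ι D hD : (F ⊗ ℝ)^ι ≃L[ℝ] ℝ^{ι × {real places}}`, `e_D a (j, v) = D_{j,v} · (a_j)_v` (§2).  On the
other
side STEP 1 (`ArchFollandTorus`): purely imaginary quadratic coordinates `IsQuadraticCoordinates Complex.ofRealHom Ψ
δ' d`
(`δ'.re = 0`), the compact diagonal torus `torusGL θ = diag(e^{iθ_j}) ∈ GL_ι(ℂ)`, the restriction-of-scalars action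
`resAut`, the adapted Folland scaling `follandScale D t` and its main computation `follandScale_resAut_torusGL`; and
the phase-space currency `realify`, `diagHom`, `torusPt` of `Analysis/SegalBargmann`.

* §2 `placeVec v a = ((a_j)_v)_j`, `scaledFrame` (`scaledFrame_apply`, `scaledFrame_symm_apply_fst`),
  `follandFreq_scaledFrame : follandFreq e_D w (j, v) = −(w_j)_v / D_{j,v}`, `archMat_diagonal`, and
  **`archFolland_scaledFrame`**: the `v`-slice of `archFolland T e_D (a, w)` is
  `follandScale (D_{·,v}) (σ_v(t₀ ·)) (a_v, w_v)` — adelic Folland coordinates ARE the adapted Folland scaling of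
  STEP 1, place by place.
* §3 **`archFolland_archAct_torus`** (the abstract form; `g ∈ Sp(W_𝔸)` is NOT hard-wired to any embedding): if `g`
  acts on archimedean pairs place by place as the torus `resAut (torusGL θ_{·,v})` in quadratic coordinates
  `(Ψ_v, δ'_v)` (hypothesis `hg` — by `rfl` the shape of `UnitaryGroup.archLocalToSymplectic … ⟨torusGL θ_v, _⟩`, §4)
  and the scaling is adapted, `im δ'_v · D_{j,v}² = ε_{j,v} · σ_v(t₀ j)` with `ε = ±1`, then
  `archFolland T e_D (archAct T g (a, w)) = realify (diagHom (torusPt (ε · θ))) (archFolland T e_D (a, w))`: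
  in the scaled Folland frame `g` is the unitary rotation `diag(e^{−iε_{j,v}θ_{j,v}})` of `ℂ^{ι × places}`
  (block-diagonal over the places); `archPhaseMap_torus` is the same as an identity of phase-space maps
  `archPhaseMap T e_D hTu g = realify (diagHom (torusPt (ε · θ)))`, and `archFolland_archAct_torus_sqrt` the canonical
  adapted choice `D_{j,v} = √(|σ_v(t₀ j)| / |im δ'_v|)`, `ε_{j,v} = sgn(im δ'_v · σ_v(t₀ j))` (`sqrt_scale_ne_zero`).
* §4 the same in the currency of a CM-type quadratic extension `E/F` with involution `c`: over each real place `v`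
  of `F` a complex place `wOf v` of `E` fixed by `c` (`hover : (wOf v).comap (F → E) = v`, so
  `realPlaceMap F E c (wOf v) = σ_v`, `realPlaceMap_eq_embedding_of_isReal`), `δ ∈ E` with `c δ = −δ ≠ 0`,
  `J = diag(t₀) ⊗ 1`; hypothesis `hg` literally over `UnitaryGroup.archLocalToSymplectic (wOf v) ⟨torusGL θ_v, _⟩`;
  conclusion **`archFolland_archAct_archLocalTorus`** with the sign vector
  `ε_{j,v} = sgn(im σ_{w(v)}(δ) · σ_{w(v)}(t₀ j))` of STEP 1's `follandScale_archLocalToSymplectic_torusGL_sqrt`.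

Combined with `arch_covariant_rhoSD_exact` (`ArchFollandCocycleOne`: the Folland cocycle is `1`), the archimedean
factor of a `ρ_T(g)`-implementer for such `g` is exactly `rhoSD`-covariant over the rotation
`realify (diagHom (torusPt (ε · θ)))` — the input shape of the Fock-space torus analysis
(`SegalBargmann.SchwartzTorusIdentification`); that consequence (STEP 3) is a separate file.

Dictionary with print: Folland [Folland1989] Prop. (4.6): under `ℝ^{2n} = ℂ^n`, `(p, q) ↔ p + iq`, `Sp ∩ O(2n) = U(n)`
and
the metaplectic representation restricted to `U(n)` is computed on the torus (Ch. 4 §1, (4.24)); `realify` is that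
identification on matrices.  The unitary group of a hermitian space over a CM extension sits in the symplectic group
of the underlying `F`-space (Mœglin–Vignéras–Waldspurger Ch. 1 I.17; tree `toSymplectic` / `archLocalToSymplectic`),
and at a real place `v` of `F` under a complex place `w` of `E` the hermitian matrix `σ_w(J)` has real diagonal
`σ_v(t₀)`; the present file is the adelic bookkeeping (frames, places, signs) around STEP 1's finite-dimensional
computation — no analysis.

## Mathlib / tree

Mathlib: `NumberField.IsTotallyReal` (`IsTotallyReal.isReal`), `NumberField.InfinitePlace.not_isReal_iff_isComplex`,
`InfinitePlace.comap`, `comap_embedding_of_isReal`, `embedding_of_isReal_apply`, `mixedEmbedding_apply_isReal`,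
`InfiniteAdeleRing.mixedEmbedding_eq_algebraMap_comp`, `LinearEquiv.toContinuousLinearEquiv`,
`Matrix.mulVec_diagonal`,
`Real.sqrt_ne_zero'`, `SignType.sign`.
Tree: `archFolland` (`archFolland_fst/snd`, `archFolland_bijective`, `archPhaseMap_archFolland`), `follandFreq`,
`piTracePairing_apply`, `mixedTrace_apply`, `archMat`, `archAct`, STEP 1 `follandScale` (`follandScale_apply`),
`follandScale_resAut_torusGL`, `realify_diagHom_torusPt`, `torusGL`, `adapted_sqrt`, `sign_eq_one_or`,
`im_ne_zero_of_isQuadraticCoordinates`, `UnitaryGroup.IsQuadraticCoordinates.resAut`, `UnitaryGroup.archLocal`,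
`UnitaryGroup.archLocalToSymplectic`, `UnitaryGroup.isQuadraticCoordinates_complex`, `UnitaryGroup.realPlaceMap`
(`realPlaceMap_apply`), `UnitaryGroup.re_embedding_delta`, `UnitaryGroup.im_embedding_delta_ne_zero`.

## References
* [Folland1989] G. B. Folland, *Harmonic Analysis in Phase Space*, Princeton UP (1989), Prop. (1.43), Ch. 4 §1,
  Prop. (4.6), (4.24).
* [Weil1964] A. Weil, *Sur certains groupes d'opérateurs unitaires*, Acta Math. 111 (1964), n° 4–5.

## Provenance

Written under the LEAN-IN-TREE rule (2026-08-18) for the pub-hodgecm formalisation cell (HAZARD γ-K (b) / D5-arch, the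
archimedean `κ`-sign: STEP 2 "torus through the adelic Folland coordinates", booked (PP′) 2026-08-19 on the spec of
the
binder-2 lane: `g` abstract with a place-by-place torus hypothesis, scaled real-place frame, conclusion in `realify ∘
diagHom ∘ torusPt` currency); reserve seat pv08 gen 24.  KERNEL only — STEP 3 (the Fock-side consequence and the
instantiation of `hg` for the cell's adelic embedding) is a separate file.  Nothing here is a claim of the sources
beyond
the cited dictionary; all statements are proved.
-/

set_option autoImplicit false

noncomputable section

open scoped Matrix Real Classical
open Complex NumberField NumberField.InfinitePlace NumberField.mixedEmbedding IsDedekindDomain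
open Literature.NumberTheory.Automorphic Literature.NumberTheory.Automorphic.UnitaryGroup
open Literature.RepresentationTheory.HeisenbergGroup Literature.Analysis.SegalBargmann

namespace Literature.NumberTheory.Weil1964

variable {F : Type} [Field F] [NumberField F] {ι : Type} [Fintype ι] [DecidableEq ι]

/-! ## §2 Real-place coordinates and the adapted (scaled) Folland frame, `F` totally real -/

section Frame

variable (F ι) in
/-- The `v`-components of an archimedean vector: `placeVec v a = ((a j)_v)_j ∈ ℝ^ι`. [folklore] -/
def placeVec (v : {v : InfinitePlace F // v.IsReal}) (a : ι → mixedSpace F) : ι → ℝ := fun j => (a j).1 v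

omit [NumberField F] [Fintype ι] [DecidableEq ι] in
/-- see `placeVec`. [folklore] -/
@[simp] theorem placeVec_apply (v : {v : InfinitePlace F // v.IsReal}) (a : ι → mixedSpace F) (j : ι) :
    placeVec F ι v a j = (a j).1 v := rfl

omit [NumberField F] in
/-- A totally real field has no complex places. [folklore] -/
theorem isEmpty_isComplex [IsTotallyReal F] : IsEmpty {w : InfinitePlace F // w.IsComplex} :=
  ⟨fun w => not_isReal_iff_isComplex.mpr w.2 (IsTotallyReal.isReal w.1)⟩

variable (F ι) in
/-- **The scaled real-place frame** `e_D a (j, v) = D_{j,v} · (a_j)_v` (`F` totally real, all `D_{j,v} ≠ 0`):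
a continuous linear isomorphism `(K_∞)^ι ≃ ℝ^{ι × {real places}}`. [folklore] -/
def scaledFrame [IsTotallyReal F] (D : ι × {v : InfinitePlace F // v.IsReal} → ℝ) (hD : ∀ k, D k ≠ 0) :
    (ι → mixedSpace F) ≃L[ℝ] ((ι × {v : InfinitePlace F // v.IsReal}) → ℝ) :=
  LinearEquiv.toContinuousLinearEquiv
    { toFun := fun a k => D k * (a k.1).1 k.2
      invFun := fun p j => (fun v => p (j, v) / D (j, v), fun _ => 0)
      map_add' := fun a b => by
        funext k
        simp only [Pi.add_apply, Prod.fst_add, mul_add]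
      map_smul' := fun c a => by
        funext k
        simp only [Pi.smul_apply, Prod.smul_fst, smul_eq_mul, RingHom.id_apply]
        ring
      left_inv := fun a => by
        haveI := isEmpty_isComplex (F := F)
        funext j
        refine Prod.ext (funext fun v => ?_) (funext fun w => isEmptyElim w)
        simp only [mul_div_cancel_left₀ _ (hD (j, v))]
      right_inv := fun p => by
        funext k
        obtain ⟨j, v⟩ := k
        simp only [mul_div_cancel₀ _ (hD (j, v))] }

omit [DecidableEq ι] in
/-- see `scaledFrame`. [folklore] -/
@[simp] theorem scaledFrame_apply [IsTotallyReal F] (D : ι × {v : InfinitePlace F // v.IsReal} → ℝ)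
    (hD : ∀ k, D k ≠ 0) (a : ι → mixedSpace F) (k : ι × {v : InfinitePlace F // v.IsReal}) :
    scaledFrame F ι D hD a k = D k * (a k.1).1 k.2 := rfl

omit [DecidableEq ι] in
/-- The inverse frame: `(e_D⁻¹ p)_j` has `v`-component `p (j, v) / D_{j,v}`. [folklore] -/
theorem scaledFrame_symm_apply_fst [IsTotallyReal F] (D : ι × {v : InfinitePlace F // v.IsReal} → ℝ)
    (hD : ∀ k, D k ≠ 0) (p : ι × {v : InfinitePlace F // v.IsReal} → ℝ) (j : ι)
    (v : {v : InfinitePlace F // v.IsReal}) :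
    ((scaledFrame F ι D hD).symm p j).1 v = p (j, v) / D (j, v) := rfl

omit [DecidableEq ι] in
/-- `follandFreq` in the scaled frame: `q_{j,v} = -(w_j)_v / D_{j,v}`. [folklore] -/
theorem follandFreq_scaledFrame [IsTotallyReal F] (D : ι × {v : InfinitePlace F // v.IsReal} → ℝ)
    (hD : ∀ k, D k ≠ 0) (w : ι → mixedSpace F) (k : ι × {v : InfinitePlace F // v.IsReal}) :
    follandFreq F ι (scaledFrame F ι D hD) w k = -((w k.1).1 k.2) / D k := by
  haveI := isEmpty_isComplex (F := F)
  rw [follandFreq, neg_div, neg_inj, piTracePairing_apply]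
  simp only [mixedTrace_apply, Finset.univ_eq_empty, Finset.sum_empty, add_zero, Prod.fst_mul,
    Pi.mul_apply, scaledFrame_symm_apply_fst, Pi.single_apply]
  rw [Finset.sum_eq_single_of_mem k.1 (Finset.mem_univ _) (fun x _ hx => Finset.sum_eq_zero fun y _ => by
      rw [if_neg (fun h => hx (congrArg Prod.fst h)), zero_div, zero_mul]),
    Finset.sum_eq_single_of_mem k.2 (Finset.mem_univ _) (fun y _ hy => by
      rw [if_neg (fun h => hy (congrArg Prod.snd h)), zero_div, zero_mul])]
  rw [if_pos (show (k.1, k.2) = k from rfl)]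
  ring

omit [Fintype ι] in
/-- The archimedean part of the rational diagonal Gram matrix `diag(t₀) ⊗ 1` is `diag(σ(t₀))`. [folklore] -/
theorem archMat_diagonal (t₀ : ι → F) :
    archMat F ι ((Matrix.diagonal t₀).map (algebraMap F (AdeleRing (𝓞 F) F))) =
      Matrix.diagonal fun j => mixedEmbedding F (t₀ j) := by
  refine Matrix.ext fun i j => ?_
  rw [Matrix.diagonal_apply]
  unfold archMat
  rw [Matrix.map_apply, Matrix.diagonal_apply]
  split_ifs with h
  · rw [InfiniteAdeleRing.mixedEmbedding_eq_algebraMap_comp]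
    rfl
  · rw [map_zero]
    exact map_zero _

/-- **Folland coordinates in the scaled frame = the adapted Folland scaling, place by place**: for
`T = diag(t₀) ⊗ 1`, the `v`-slice of `Ξ_{e_D}(a, w)` is `follandScale (D_{·,v}) (σ_v(t₀ ·)) (a_v, w_v)`.
[cite: Folland1989, Prop. (1.43)] -/
theorem archFolland_scaledFrame [IsTotallyReal F] (t₀ : ι → F) {T : Matrix ι ι (AdeleRing (𝓞 F) F)}
    (hT : T = (Matrix.diagonal t₀).map (algebraMap F (AdeleRing (𝓞 F) F)))
    (D : ι × {v : InfinitePlace F // v.IsReal} → ℝ) (hD : ∀ k, D k ≠ 0) (a w : ι → mixedSpace F)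
    (v : {v : InfinitePlace F // v.IsReal}) :
    ((fun j => (archFolland T (scaledFrame F ι D hD) (a, w)).1 (j, v)),
        (fun j => (archFolland T (scaledFrame F ι D hD) (a, w)).2 (j, v))) =
      follandScale (fun j => D (j, v)) (fun j => embedding_of_isReal v.2 (t₀ j))
        (placeVec F ι v a, placeVec F ι v w) := by
  subst hT
  refine Prod.ext (funext fun j => ?_) (funext fun j => ?_)
  · simp only [archFolland_fst, scaledFrame_apply, follandScale_apply, placeVec_apply]
  · simp only [archFolland_snd, follandFreq_scaledFrame, archMat_diagonal, Matrix.mulVec_diagonal,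
      Prod.fst_mul, Pi.mul_apply, mixedEmbedding_apply_isReal, follandScale_apply, placeVec_apply]
    ring

end Frame

/-! ## §3 The place-by-place torus in the scaled Folland frame -/

section Torus

variable [IsTotallyReal F]

/-- **STEP 2 (abstract form): the place-by-place torus is a unitary rotation in the scaled Folland frame.**
Let `T = diag(t₀) ⊗ 1` (`t₀ : ι → F`), let `g ∈ Sp(W_𝔸)` act on archimedean pairs PLACE BY PLACE as the compact
diagonal torus `diag(e^{iθ_{·,v}})` read in purely imaginary quadratic coordinates `(Ψ_v, δ'_v)` (hypothesis `hg`;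
by `rfl` the shape of `UnitaryGroup.archLocalToSymplectic … ⟨torusGL θ_v, _⟩`), and let the scaling `D` be adapted,
`im δ'_v · D_{j,v}² = ε_{j,v} · σ_v(t₀ j)` with `ε = ±1`.  Then
`archFolland T e_D (archAct T g (a, w)) = realify (diagHom (torusPt (ε · θ))) (archFolland T e_D (a, w))`.
[cite: Folland1989, Ch. 4 §1, Prop. (4.6) p. 151] -/
theorem archFolland_archAct_torus (t₀ : ι → F) {T : Matrix ι ι (AdeleRing (𝓞 F) F)}
    (hT : T = (Matrix.diagonal t₀).map (algebraMap F (AdeleRing (𝓞 F) F)))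
    {Ψ : {v : InfinitePlace F // v.IsReal} → ((ℝ × ℝ) ≃+ ℂ)} {δ' : {v : InfinitePlace F // v.IsReal} → ℂ}
    {d : {v : InfinitePlace F // v.IsReal} → ℝ}
    (hq : ∀ v, IsQuadraticCoordinates Complex.ofRealHom (Ψ v) (δ' v) (d v)) (hre : ∀ v, (δ' v).re = 0)
    {D ε : ι × {v : InfinitePlace F // v.IsReal} → ℝ} (hD0 : ∀ k, D k ≠ 0)
    (hD : ∀ k, (δ' k.2).im * D k ^ 2 = ε k * embedding_of_isReal k.2.2 (t₀ k.1))
    (hε : ∀ k, ε k = 1 ∨ ε k = -1)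
    (g : symplecticGroup (polar (adelicForm F ι T))) (θ : ι × {v : InfinitePlace F // v.IsReal} → ℝ)
    (hg : ∀ (a w : ι → mixedSpace F) (v : {v : InfinitePlace F // v.IsReal}),
      (placeVec F ι v (archAct T g (a, w)).1, placeVec F ι v (archAct T g (a, w)).2) =
        (hq v).resAut ι (torusGL fun j => θ (j, v)) (placeVec F ι v a, placeVec F ι v w))
    (a w : ι → mixedSpace F) :
    archFolland T (scaledFrame F ι D hD0) (archAct T g (a, w)) =
      realify (diagHom (torusPt fun k => ε k * θ k)) (archFolland T (scaledFrame F ι D hD0) (a, w)) := by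
  have hplace : ∀ v : {v : InfinitePlace F // v.IsReal},
      ((fun j => (archFolland T (scaledFrame F ι D hD0) (archAct T g (a, w))).1 (j, v)),
        (fun j => (archFolland T (scaledFrame F ι D hD0) (archAct T g (a, w))).2 (j, v))) =
      realify (diagHom (torusPt fun j => ε (j, v) * θ (j, v)))
        ((fun j => (archFolland T (scaledFrame F ι D hD0) (a, w)).1 (j, v)),
          (fun j => (archFolland T (scaledFrame F ι D hD0) (a, w)).2 (j, v))) := by
    intro v
    have ht : ∀ j, embedding_of_isReal v.2 (t₀ j) ≠ 0 := fun j h0 => by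
      have h := hD (j, v)
      rw [h0, mul_zero] at h
      exact mul_ne_zero (im_ne_zero_of_isQuadraticCoordinates (hq v) (hre v)) (pow_ne_zero 2 (hD0 (j, v))) h
    rw [show archAct T g (a, w) = ((archAct T g (a, w)).1, (archAct T g (a, w)).2) from rfl,
      archFolland_scaledFrame t₀ hT, archFolland_scaledFrame t₀ hT, hg a w v]
    exact follandScale_resAut_torusGL (hq v) (hre v) ht (fun j => hD (j, v)) (fun j => hε (j, v)) _ _
  refine Prod.ext (funext fun k => ?_) (funext fun k => ?_)
  · obtain ⟨j, v⟩ := k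
    have h1 := congrArg (fun pq : (ι → ℝ) × (ι → ℝ) => pq.1 j) (hplace v)
    simp only [realify_diagHom_torusPt] at h1 ⊢
    exact h1
  · obtain ⟨j, v⟩ := k
    have h1 := congrArg (fun pq : (ι → ℝ) × (ι → ℝ) => pq.2 j) (hplace v)
    simp only [realify_diagHom_torusPt] at h1 ⊢
    exact h1

/-- **STEP 2 as a phase-space map**: `Ξ ∘ (g·) ∘ Ξ⁻¹ = realify (diagHom (torusPt (ε · θ)))`. [cite: Folland1989, Ch. 4 §1, Prop. (4.6) p. 151] -/
theorem archPhaseMap_torus (t₀ : ι → F) {T : Matrix ι ι (AdeleRing (𝓞 F) F)}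
    (hT : T = (Matrix.diagonal t₀).map (algebraMap F (AdeleRing (𝓞 F) F))) (hTu : IsUnit (archMat F ι T))
    {Ψ : {v : InfinitePlace F // v.IsReal} → ((ℝ × ℝ) ≃+ ℂ)} {δ' : {v : InfinitePlace F // v.IsReal} → ℂ}
    {d : {v : InfinitePlace F // v.IsReal} → ℝ}
    (hq : ∀ v, IsQuadraticCoordinates Complex.ofRealHom (Ψ v) (δ' v) (d v)) (hre : ∀ v, (δ' v).re = 0)
    {D ε : ι × {v : InfinitePlace F // v.IsReal} → ℝ} (hD0 : ∀ k, D k ≠ 0)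
    (hD : ∀ k, (δ' k.2).im * D k ^ 2 = ε k * embedding_of_isReal k.2.2 (t₀ k.1))
    (hε : ∀ k, ε k = 1 ∨ ε k = -1)
    (g : symplecticGroup (polar (adelicForm F ι T))) (θ : ι × {v : InfinitePlace F // v.IsReal} → ℝ)
    (hg : ∀ (a w : ι → mixedSpace F) (v : {v : InfinitePlace F // v.IsReal}),
      (placeVec F ι v (archAct T g (a, w)).1, placeVec F ι v (archAct T g (a, w)).2) =
        (hq v).resAut ι (torusGL fun j => θ (j, v)) (placeVec F ι v a, placeVec F ι v w)) :
    archPhaseMap T (scaledFrame F ι D hD0) hTu g = realify (diagHom (torusPt fun k => ε k * θ k)) := by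
  funext pq
  obtain ⟨⟨a, w⟩, rfl⟩ := (archFolland_bijective (T := T) (scaledFrame F ι D hD0) hTu).2 pq
  rw [archPhaseMap_archFolland]
  exact archFolland_archAct_torus t₀ hT hq hre hD0 hD hε g θ hg a w

omit [NumberField F] [Fintype ι] [DecidableEq ι] [IsTotallyReal F] in
/-- The canonical adapted scaling is nowhere zero (`t₀ j ≠ 0`, `im δ'_v ≠ 0`). [folklore] -/
theorem sqrt_scale_ne_zero (t₀ : ι → F) (ht₀ : ∀ j, t₀ j ≠ 0)
    {Ψ : {v : InfinitePlace F // v.IsReal} → ((ℝ × ℝ) ≃+ ℂ)} {δ' : {v : InfinitePlace F // v.IsReal} → ℂ}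
    {d : {v : InfinitePlace F // v.IsReal} → ℝ}
    (hq : ∀ v, IsQuadraticCoordinates Complex.ofRealHom (Ψ v) (δ' v) (d v)) (hre : ∀ v, (δ' v).re = 0)
    (k : ι × {v : InfinitePlace F // v.IsReal}) :
    Real.sqrt (|embedding_of_isReal k.2.2 (t₀ k.1)| / |(δ' k.2).im|) ≠ 0 :=
  Real.sqrt_ne_zero'.mpr (div_pos
    (abs_pos.mpr ((map_ne_zero_iff _ (embedding_of_isReal k.2.2).injective).mpr (ht₀ k.1)))
    (abs_pos.mpr (im_ne_zero_of_isQuadraticCoordinates (hq k.2) (hre k.2))))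

/-- **Canonical adapted scaling** `D_{j,v} = √(|σ_v(t₀ j)| / |im δ'_v|)`, sign vector
`ε_{j,v} = sgn(im δ'_v · σ_v(t₀ j))`. [cite: Folland1989, Ch. 4 §1, Prop. (4.6) p. 151] -/
theorem archFolland_archAct_torus_sqrt (t₀ : ι → F) (ht₀ : ∀ j, t₀ j ≠ 0) {T : Matrix ι ι (AdeleRing (𝓞 F) F)}
    (hT : T = (Matrix.diagonal t₀).map (algebraMap F (AdeleRing (𝓞 F) F)))
    {Ψ : {v : InfinitePlace F // v.IsReal} → ((ℝ × ℝ) ≃+ ℂ)} {δ' : {v : InfinitePlace F // v.IsReal} → ℂ}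
    {d : {v : InfinitePlace F // v.IsReal} → ℝ}
    (hq : ∀ v, IsQuadraticCoordinates Complex.ofRealHom (Ψ v) (δ' v) (d v)) (hre : ∀ v, (δ' v).re = 0)
    (g : symplecticGroup (polar (adelicForm F ι T))) (θ : ι × {v : InfinitePlace F // v.IsReal} → ℝ)
    (hg : ∀ (a w : ι → mixedSpace F) (v : {v : InfinitePlace F // v.IsReal}),
      (placeVec F ι v (archAct T g (a, w)).1, placeVec F ι v (archAct T g (a, w)).2) =
        (hq v).resAut ι (torusGL fun j => θ (j, v)) (placeVec F ι v a, placeVec F ι v w))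
    (a w : ι → mixedSpace F) :
    archFolland T (scaledFrame F ι (fun k => Real.sqrt (|embedding_of_isReal k.2.2 (t₀ k.1)| / |(δ' k.2).im|))
        (sqrt_scale_ne_zero t₀ ht₀ hq hre)) (archAct T g (a, w)) =
      realify (diagHom (torusPt fun k =>
          (SignType.sign ((δ' k.2).im * embedding_of_isReal k.2.2 (t₀ k.1)) : ℝ) * θ k))
        (archFolland T (scaledFrame F ι (fun k => Real.sqrt (|embedding_of_isReal k.2.2 (t₀ k.1)| / |(δ' k.2).im|))
          (sqrt_scale_ne_zero t₀ ht₀ hq hre)) (a, w)) :=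
  archFolland_archAct_torus t₀ hT hq hre (sqrt_scale_ne_zero t₀ ht₀ hq hre)
    (fun k => adapted_sqrt (im_ne_zero_of_isQuadraticCoordinates (hq k.2) (hre k.2))
      (fun j => embedding_of_isReal k.2.2 (t₀ j)) k.1)
    (fun k => sign_eq_one_or (im_ne_zero_of_isQuadraticCoordinates (hq k.2) (hre k.2))
      (fun j => (map_ne_zero_iff _ (embedding_of_isReal k.2.2).injective).mpr (ht₀ j)) k.1)
    g θ hg a w

end Torus

/-! ## §4 In the currency of a CM-type quadratic extension `E/F`: `archLocalToSymplectic` at the place over `v` -/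

section CM

variable (E : Type) [Field E] [NumberField E] [Algebra F E] (c : E ≃ₐ[F] E)

omit [Fintype ι] [DecidableEq ι] in
/-- **The real embedding read at a complex place `w` of `E` over the real place `v` of `F` is `σ_v`**:
`Re σ_w(t) = σ_v(t)` for `t ∈ F` when `w ∘ (F → E) = v`. [folklore] -/
theorem realPlaceMap_eq_embedding_of_isReal (w : {w : InfinitePlace E // w.IsComplex}) (hw : c • w.1 = w.1)
    (hc : c ≠ 1) (v : {v : InfinitePlace F // v.IsReal}) (hover : w.1.comap (algebraMap F E) = v.1) (t : F) :
    UnitaryGroup.realPlaceMap F E c w hw hc t = embedding_of_isReal v.2 t := by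
  have hvr : (w.1.comap (algebraMap F E)).IsReal := by rw [hover]; exact v.2
  have h2 : v.1.embedding = w.1.embedding.comp (algebraMap F E) := by
    have h := comap_embedding_of_isReal (algebraMap F E) hvr
    rwa [hover] at h
  have h1 : (embedding_of_isReal v.2 t : ℂ) = v.1.embedding t := embedding_of_isReal_apply v.2 t
  rw [UnitaryGroup.realPlaceMap_apply, ← RingHom.comp_apply, ← h2, ← h1, Complex.ofReal_re]

variable (N : ℕ) [IsTotallyReal F]

/-- **STEP 2 in `archLocalToSymplectic` currency.** For each real place `v` of `F` let `wOf v` be a complex place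
of `E` over `v` fixed by the involution `c ≠ 1`; let `δ ∈ E` with `c δ = −δ ≠ 0` and `J = diag(t₀) ⊗ 1`, `t₀ j ≠ 0`.
If `g ∈ Sp(W_𝔸)` acts on archimedean pairs place by place as `archLocalToSymplectic (wOf v) ⟨torusGL θ_{·,v}, _⟩`
(hypothesis `hg`), then in the canonically scaled Folland frame (`D_{j,v} = √(|σ_v(t₀ j)| / |im σ_{w(v)}(δ)|)`) it is
the unitary rotation `realify (diagHom (torusPt (ε · θ)))`, `ε_{j,v} = sgn(im σ_{w(v)}(δ) · σ_{w(v)}(t₀ j))` — the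
sign vector of `follandScale_archLocalToSymplectic_torusGL_sqrt`. [cite: Folland1989, Ch. 4 §1, Prop. (4.6) p. 151] -/
theorem archFolland_archAct_archLocalTorus {δ : E} (hcδ : c δ = -δ) (hδ : δ ≠ 0) (hc : c ≠ 1)
    (wOf : {v : InfinitePlace F // v.IsReal} → {w : InfinitePlace E // w.IsComplex})
    (hw : ∀ v, c • (wOf v).1 = (wOf v).1) (hover : ∀ v, (wOf v).1.comap (algebraMap F E) = v.1)
    (t₀ : Fin N → F) (ht₀ : ∀ j, t₀ j ≠ 0) (hTs : (Matrix.diagonal t₀).IsSymm)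
    {J : Matrix (Fin N) (Fin N) E} (hJ : J = (Matrix.diagonal t₀).map (algebraMap F E))
    {T : Matrix (Fin N) (Fin N) (AdeleRing (𝓞 F) F)}
    (hT : T = (Matrix.diagonal t₀).map (algebraMap F (AdeleRing (𝓞 F) F)))
    (g : symplecticGroup (polar (adelicForm F (Fin N) T))) (θ : Fin N × {v : InfinitePlace F // v.IsReal} → ℝ)
    (hmem : ∀ v, torusGL (fun j => θ (j, v)) ∈ UnitaryGroup.archLocal E N J (wOf v))
    (hg : ∀ (a w : Fin N → mixedSpace F) (v : {v : InfinitePlace F // v.IsReal}),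
      (placeVec F (Fin N) v (archAct T g (a, w)).1, placeVec F (Fin N) v (archAct T g (a, w)).2) =
        (UnitaryGroup.archLocalToSymplectic F E c N (wOf v) (hw v) hc hcδ hδ hTs hJ
          ⟨torusGL fun j => θ (j, v), hmem v⟩).1 (placeVec F (Fin N) v a, placeVec F (Fin N) v w))
    (hD0 : ∀ k : Fin N × {v : InfinitePlace F // v.IsReal},
      Real.sqrt (|UnitaryGroup.realPlaceMap F E c (wOf k.2) (hw k.2) hc (t₀ k.1)| / |((wOf k.2).1.embedding δ).im|)
        ≠ 0)
    (a w : Fin N → mixedSpace F) :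
    archFolland T (scaledFrame F (Fin N)
        (fun k => Real.sqrt (|UnitaryGroup.realPlaceMap F E c (wOf k.2) (hw k.2) hc (t₀ k.1)| /
          |((wOf k.2).1.embedding δ).im|)) hD0) (archAct T g (a, w)) =
      realify (diagHom (torusPt fun k =>
          (SignType.sign (((wOf k.2).1.embedding δ).im *
            UnitaryGroup.realPlaceMap F E c (wOf k.2) (hw k.2) hc (t₀ k.1)) : ℝ) * θ k))
        (archFolland T (scaledFrame F (Fin N)
          (fun k => Real.sqrt (|UnitaryGroup.realPlaceMap F E c (wOf k.2) (hw k.2) hc (t₀ k.1)| /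
            |((wOf k.2).1.embedding δ).im|)) hD0) (a, w)) := by
  have hq' := fun v : {v : InfinitePlace F // v.IsReal} =>
    UnitaryGroup.isQuadraticCoordinates_complex ((wOf v).1.embedding δ)
      (UnitaryGroup.re_embedding_delta F E c (wOf v) (hw v) hc hcδ) (UnitaryGroup.im_embedding_delta_ne_zero F E c (wOf v) (hw v) hc hcδ hδ)
  have hg' : ∀ (a w : Fin N → mixedSpace F) (v : {v : InfinitePlace F // v.IsReal}),
      (placeVec F (Fin N) v (archAct T g (a, w)).1, placeVec F (Fin N) v (archAct T g (a, w)).2) =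
        (hq' v).resAut (Fin N) (torusGL fun j => θ (j, v)) (placeVec F (Fin N) v a, placeVec F (Fin N) v w) :=
    fun a w v => by rw [hg a w v]; rfl
  have ht : ∀ k : Fin N × {v : InfinitePlace F // v.IsReal},
      UnitaryGroup.realPlaceMap F E c (wOf k.2) (hw k.2) hc (t₀ k.1) = embedding_of_isReal k.2.2 (t₀ k.1) :=
    fun k => realPlaceMap_eq_embedding_of_isReal E c (wOf k.2) (hw k.2) hc k.2 (hover k.2) (t₀ k.1)
  refine archFolland_archAct_torus t₀ hT hq' (fun v => UnitaryGroup.re_embedding_delta F E c (wOf v) (hw v) hc hcδ)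
    hD0 (fun k => ?_) (fun k => ?_) g θ hg' a w
  · rw [← ht k]
    exact adapted_sqrt (UnitaryGroup.im_embedding_delta_ne_zero F E c (wOf k.2) (hw k.2) hc hcδ hδ)
      (fun j => UnitaryGroup.realPlaceMap F E c (wOf k.2) (hw k.2) hc (t₀ j)) k.1
  · exact sign_eq_one_or (UnitaryGroup.im_embedding_delta_ne_zero F E c (wOf k.2) (hw k.2) hc hcδ hδ)
      (fun j => (map_ne_zero_iff _ (UnitaryGroup.realPlaceMap F E c (wOf k.2) (hw k.2) hc).injective).mpr (ht₀ j))
      k.1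

omit [IsTotallyReal F] in
/-- The canonical CM scaling is nowhere zero. [folklore] -/
theorem sqrt_scale_ne_zero_CM {δ : E} (hcδ : c δ = -δ) (hδ : δ ≠ 0) (hc : c ≠ 1)
    (wOf : {v : InfinitePlace F // v.IsReal} → {w : InfinitePlace E // w.IsComplex})
    (hw : ∀ v, c • (wOf v).1 = (wOf v).1) (t₀ : Fin N → F) (ht₀ : ∀ j, t₀ j ≠ 0)
    (k : Fin N × {v : InfinitePlace F // v.IsReal}) :
    Real.sqrt (|UnitaryGroup.realPlaceMap F E c (wOf k.2) (hw k.2) hc (t₀ k.1)| / |((wOf k.2).1.embedding δ).im|)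
      ≠ 0 :=
  Real.sqrt_ne_zero'.mpr (div_pos
    (abs_pos.mpr ((map_ne_zero_iff _ (UnitaryGroup.realPlaceMap F E c (wOf k.2) (hw k.2) hc).injective).mpr
      (ht₀ k.1)))
    (abs_pos.mpr (UnitaryGroup.im_embedding_delta_ne_zero F E c (wOf k.2) (hw k.2) hc hcδ hδ)))

end CM

end Literature.NumberTheory.Weil1964

end
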